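import Mathlib.RingTheory.MvPolynomial.Basic
import Mathlib.Algebra.MvPolynomial.Degrees
import Mathlib.Algebra.MvPolynomial.CommRing
import Mathlib.Algebra.MvPolynomial.Monad
import Mathlib.Algebra.Order.BigOperators.Ring.Finset
import Mathlib.Analysis.Complex.Basic
import Literature.Computability.Complexity.NullstellensatzRefutation
import HarnessLib

/-!
# Static Positivstellensatz (sum-of-squares) refutations and realification of complex systems

Definition request `defn-HasSOSRefutation` (route MatrixMultiplication/BrentRefutationDepth: the
SOS-depth versions of its items, e.g. `ThreeByThreeTwenty`, `RealThreeByThreeTwenty`), placed next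
to the Nullstellensatz vocabulary of `NullstellensatzRefutation.lean` (`HasNSRefutationOfDegree`,
`HasNSRefutationWithMultipliersOfDegree`). Everything here is a real definition or a proved lemma;
no named facts.

* `HasSOSRefutation S d` — a **static Positivstellensatz refutation of (half-)degree `d`** of the
  system of polynomial EQUATIONS `{S e = 0}_e` over an ordered ring (the route: `ℝ`):
  `Σ_l q_l² + Σ_e g_e · S e = -1` with `deg q_l ≤ d` and `deg (g_e · S e) ≤ 2d`. This is
  Grigoriev–Vorobjov's static system `PS>` [Grigoriev2001, Def. 0.5] specialised to equations only
  (no inequality axioms `h_i ≥ 0`, so the cone element is "just a sum of squares", loc. cit.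
  Remark 0.3 / p. 4), whose degree is `max{deg(f_s g_s), deg(e_j²)}` — here `≤ 2d`.
  DEGREE CONVENTIONS side by side: NS (`HasNSRefutationOfDegree 𝒜 d`): every product `g a · 𝒜 a`
  has total degree `≤ d` (multiplier form `…WithMultipliersOfDegree 𝒜 D`: `deg g a ≤ D`);
  SOS (`HasSOSRefutation S d`): squares of polynomials of degree `≤ d`, products of degree `≤ 2d`.
* Proved: soundness (`HasSOSRefutation.no_common_zero`: a refuted system has no common zero in
  the ordered coefficient ring), monotonicity in `d`, and `NS ⇒ SOS`
  (`HasNSRefutationOfDegree S (2d) → HasSOSRefutation S d`, multiply by `-1`, no squares).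
* `reCoeff`, `imCoeff` — real and imaginary parts of a polynomial with complex coefficients
  (coefficientwise), with `map ofReal (reCoeff Q) + C I * map ofReal (imCoeff Q) = Q` and the
  evaluation rule at real points; `realifyVars` — the substitution `X s ↦ X (s,false) + i X (s,true)`;
  `realify P = (reCoeff (realifyVars P), imCoeff (realifyVars P))` and the realified system
  `realifySystem S : ι × Bool → ℝ[σ × Bool]` (both parts of every equation).
* Proved: `eval z (S e) = eval y (re part) + i · eval y (im part)` for `y = (re z, im z)`
  (`eval_eq_realify`), hence **a complex system has a common zero iff its realification has a real
  common zero** (`exists_common_zero_iff_realify`), and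
  `HasSOSRefutation (realifySystem S) d → ∀ z, ∃ e, eval z (S e) ≠ 0`
  (`HasSOSRefutation.no_complex_zero`).

## References

* D. Grigoriev, *Complexity of Positivstellensatz proofs for the knapsack*, Comput. Complexity 10
  (2001) 139–154, Def. 0.5 (static Positivstellensatz refutations `PS>`, their degree), Remark
  0.3 / p. 4 (equations only: the cone part is a sum of squares); after D. Grigoriev,
  N. Vorobjov, *Complexity of Null- and Positivstellensatz proofs*, APAL 113 (2001).
  [Grigoriev2001] (held text `paper:doi-10-1007-s00037-001-8192-0`, pp. 3–4).
* J. Krajíček, *Proof Complexity*, CUP 2019, §6.2 (NS and its degree). [KrajicekProofComplexity2019]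
-/

noncomputable section

open MvPolynomial Finset

namespace Literature.Computability.Complexity

/-! ### Static sum-of-squares (Positivstellensatz) refutations -/

section SOS

variable {ι σ K : Type*} [CommRing K]

/-- **Static Positivstellensatz / sum-of-squares refutation of (half-)degree `d`** of the system of
equations `{S e = 0}_{e : ι}`: polynomials `q_1, …, q_m` of total degree `≤ d` and multipliers
`g_e` with every product `g_e · S e` of total degree `≤ 2d`, such that
`Σ_l q_l² + Σ_e g_e · S e = -1`. Grigoriev–Vorobjov's `PS>` refutation for systems of equations
(cone part = a sum of squares), of degree `≤ 2d`. Over an ordered ring it certifies that the system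
has no common zero (`HasSOSRefutation.no_common_zero`). [cite: Grigoriev2001, Def. 0.5] -/
def HasSOSRefutation [Fintype ι] (S : ι → MvPolynomial σ K) (d : ℕ) : Prop :=
  ∃ (m : ℕ) (q : Fin m → MvPolynomial σ K) (g : ι → MvPolynomial σ K),
    (∀ l, (q l).totalDegree ≤ d) ∧ (∀ e, (g e * S e).totalDegree ≤ 2 * d) ∧
      (∑ l, q l * q l) + ∑ e, g e * S e = -1

/-- The degree bound is monotone. [folklore] -/
theorem HasSOSRefutation.mono [Fintype ι] {S : ι → MvPolynomial σ K} {d d' : ℕ}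
    (h : HasSOSRefutation S d) (hd : d ≤ d') : HasSOSRefutation S d' := by
  obtain ⟨m, q, g, hq, hg, hsum⟩ := h
  exact ⟨m, q, g, fun l => (hq l).trans hd, fun e => (hg e).trans (by omega), hsum⟩

/-- **NS ⇒ SOS**: a Nullstellensatz refutation of degree `≤ 2d` (`Σ g_a 𝒜 a = 1`, products of
degree `≤ 2d`) is, after multiplication by `-1`, a static Positivstellensatz refutation of
half-degree `d` with no squares ("PS> is stronger than NS refutations", Grigoriev 2001, p. 3).
[cite: Grigoriev2001, p. 3 (PS> stronger than NS)] -/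
theorem HasNSRefutationOfDegree.hasSOSRefutation [Fintype ι] [DecidableEq ι]
    {S : ι → MvPolynomial σ K} {d : ℕ} (h : HasNSRefutationOfDegree S (2 * d)) :
    HasSOSRefutation S d := by
  obtain ⟨s, g, hsum, hdeg⟩ := h
  refine ⟨0, Fin.elim0, fun e => if e ∈ s then -g e else 0, fun l => l.elim0, fun e => ?_, ?_⟩
  · by_cases he : e ∈ s
    · simp only [he, ite_true, neg_mul, totalDegree_neg]
      exact hdeg e he
    · simp [he]
  · simp only [Finset.univ_eq_empty, Finset.sum_empty, zero_add]
    rw [← Finset.sum_subset (Finset.subset_univ s) (fun e _ he => by simp [he])]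
    rw [show ∑ e ∈ s, (if e ∈ s then -g e else 0) * S e = -∑ e ∈ s, g e * S e by
      rw [← Finset.sum_neg_distrib]
      exact Finset.sum_congr rfl fun e he => by simp [he]]
    rw [hsum]

/-- **Soundness of SOS refutations**: over an ordered ring a statically refuted system of
equations has no common zero — at a common zero the identity evaluates to `Σ (q_l x)² = -1`.
[cite: Grigoriev2001, §0 (Positivstellensatz)] -/
theorem HasSOSRefutation.no_common_zero {K : Type*} [CommRing K] [LinearOrder K]
    [IsStrictOrderedRing K] [Fintype ι] {S : ι → MvPolynomial σ K} {d : ℕ}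
    (h : HasSOSRefutation S d) (x : σ → K) : ∃ e, MvPolynomial.eval x (S e) ≠ 0 := by
  by_contra hx
  simp only [not_exists, not_not] at hx
  obtain ⟨m, q, g, -, -, hsum⟩ := h
  have hev := congrArg (MvPolynomial.eval x) hsum
  simp only [map_add, map_sum, map_mul, hx, mul_zero, Finset.sum_const_zero, add_zero, map_neg,
    map_one] at hev
  have hnonneg : (0 : K) ≤ ∑ l, MvPolynomial.eval x (q l) * MvPolynomial.eval x (q l) :=
    Finset.sum_nonneg fun l _ => mul_self_nonneg _
  rw [hev] at hnonneg
  linarith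

end SOS

/-! ### Real and imaginary parts of complex polynomials; realification -/

section Realify

variable {τ : Type*}

/-- The **real part** of a polynomial with complex coefficients, coefficientwise. [folklore] -/
def reCoeff (Q : MvPolynomial τ ℂ) : MvPolynomial τ ℝ :=
  ∑ m ∈ Q.support, monomial m (Q.coeff m).re

/-- The **imaginary part** of a polynomial with complex coefficients, coefficientwise. [folklore] -/
def imCoeff (Q : MvPolynomial τ ℂ) : MvPolynomial τ ℝ :=
  ∑ m ∈ Q.support, monomial m (Q.coeff m).im

/-- Coefficients of the real part. [folklore] -/
@[simp] theorem coeff_reCoeff (Q : MvPolynomial τ ℂ) (n : τ →₀ ℕ) :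
    (reCoeff Q).coeff n = (Q.coeff n).re := by
  classical
  unfold reCoeff
  rw [coeff_sum]
  simp only [coeff_monomial]
  rw [Finset.sum_ite_eq']
  split_ifs with hn
  · rfl
  · rw [MvPolynomial.notMem_support_iff.mp hn, Complex.zero_re]

/-- Coefficients of the imaginary part. [folklore] -/
@[simp] theorem coeff_imCoeff (Q : MvPolynomial τ ℂ) (n : τ →₀ ℕ) :
    (imCoeff Q).coeff n = (Q.coeff n).im := by
  classical
  unfold imCoeff
  rw [coeff_sum]
  simp only [coeff_monomial]
  rw [Finset.sum_ite_eq']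
  split_ifs with hn
  · rfl
  · rw [MvPolynomial.notMem_support_iff.mp hn, Complex.zero_im]

/-- `Q = Re Q + i · Im Q` coefficientwise. [folklore] -/
theorem map_reCoeff_add_imCoeff (Q : MvPolynomial τ ℂ) :
    MvPolynomial.map Complex.ofRealHom (reCoeff Q) +
        C Complex.I * MvPolynomial.map Complex.ofRealHom (imCoeff Q) = Q := by
  ext n
  simp only [coeff_add, coeff_map, coeff_reCoeff, coeff_C_mul, coeff_imCoeff,
    Complex.ofRealHom_eq_coe]
  apply Complex.ext <;> simp

/-- Evaluating a real polynomial, mapped to `ℂ`, at a real point. [folklore] -/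
theorem eval_ofReal_map (A : MvPolynomial τ ℝ) (y : τ → ℝ) :
    MvPolynomial.eval (fun t => (y t : ℂ)) (MvPolynomial.map Complex.ofRealHom A) =
      ((MvPolynomial.eval y A : ℝ) : ℂ) := by
  rw [MvPolynomial.eval_map]
  have h := MvPolynomial.eval₂_comp_left Complex.ofRealHom (RingHom.id ℝ) y A
  rw [MvPolynomial.eval₂_id, RingHom.comp_id] at h
  rw [show (fun t => (y t : ℂ)) = (⇑Complex.ofRealHom ∘ y) from rfl]
  exact h.symm

/-- **Evaluation at a real point splits into real and imaginary parts**: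
`Q(y) = (Re Q)(y) + i (Im Q)(y)` for `y` real. [folklore] -/
theorem eval_ofReal_eq (Q : MvPolynomial τ ℂ) (y : τ → ℝ) :
    MvPolynomial.eval (fun t => (y t : ℂ)) Q =
      ((MvPolynomial.eval y (reCoeff Q) : ℝ) : ℂ) +
        Complex.I * ((MvPolynomial.eval y (imCoeff Q) : ℝ) : ℂ) := by
  conv_lhs => rw [← map_reCoeff_add_imCoeff Q]
  rw [map_add, map_mul, eval_C, eval_ofReal_map, eval_ofReal_map]

variable {σ : Type*}

/-- The substitution `X s ↦ X (s, false) + i · X (s, true)` (real and imaginary coordinates).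
[folklore] -/
def realifyVars : MvPolynomial σ ℂ →ₐ[ℂ] MvPolynomial (σ × Bool) ℂ :=
  bind₁ fun s => X (s, false) + C Complex.I * X (s, true)

/-- **Realification** of a complex polynomial: the pair (real part, imaginary part) of
`P(X_{s,0} + i X_{s,1})`, two real polynomials in the doubled set of variables `σ × Bool`.
[folklore] -/
def realify (P : MvPolynomial σ ℂ) : MvPolynomial (σ × Bool) ℝ × MvPolynomial (σ × Bool) ℝ :=
  (reCoeff (realifyVars P), imCoeff (realifyVars P))

/-- The **realified system** of a complex system `S`: both parts of every equation, indexed by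
`ι × Bool` (`false` ↦ real part, `true` ↦ imaginary part). [folklore] -/
def realifySystem {ι : Type*} (S : ι → MvPolynomial σ ℂ) : ι × Bool → MvPolynomial (σ × Bool) ℝ :=
  fun p => if p.2 then (realify (S p.1)).2 else (realify (S p.1)).1

/-- The real coordinates of a complex point: `(s, false) ↦ re z_s`, `(s, true) ↦ im z_s`.
[folklore] -/
def realCoords (z : σ → ℂ) : σ × Bool → ℝ :=
  fun p => if p.2 then (z p.1).im else (z p.1).re

/-- The complex point with given real coordinates: `z_s = y (s,false) + i y (s,true)`. [folklore] -/
def complexPoint (y : σ × Bool → ℝ) : σ → ℂ :=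
  fun s => (y (s, false) : ℂ) + Complex.I * (y (s, true) : ℂ)

/-- `realCoords` inverts `complexPoint`. [folklore] -/
@[simp] theorem realCoords_complexPoint (y : σ × Bool → ℝ) : realCoords (complexPoint y) = y := by
  funext ⟨s, b⟩
  cases b <;> simp [realCoords, complexPoint]

/-- `complexPoint` inverts `realCoords`. [folklore] -/
@[simp] theorem complexPoint_realCoords (z : σ → ℂ) : complexPoint (realCoords z) = z := by
  funext s
  simp only [complexPoint, realCoords]
  apply Complex.ext <;> simp

/-- Substituting real coordinates undoes `realifyVars`:
`(realifyVars P)(realCoords z) = P(z)`. [folklore] -/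
theorem eval_realifyVars (P : MvPolynomial σ ℂ) (z : σ → ℂ) :
    MvPolynomial.eval (fun p => (realCoords z p : ℂ)) (realifyVars P) = MvPolynomial.eval z P := by
  unfold realifyVars
  change eval₂Hom (RingHom.id ℂ) _ (bind₁ _ P) = _
  rw [eval₂Hom_bind₁]
  change MvPolynomial.eval (fun s => MvPolynomial.eval (fun p => (realCoords z p : ℂ))
    (X (s, false) + C Complex.I * X (s, true))) P = _
  congr 2
  funext s
  simp only [map_add, map_mul, eval_X, eval_C, realCoords]
  apply Complex.ext <;> simp

/-- **`P(z) = (Re P̂)(y) + i (Im P̂)(y)`** with `P̂ = realifyVars P` and `y = realCoords z`.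
[folklore] -/
theorem eval_eq_realify (P : MvPolynomial σ ℂ) (z : σ → ℂ) :
    MvPolynomial.eval z P =
      ((MvPolynomial.eval (realCoords z) (realify P).1 : ℝ) : ℂ) +
        Complex.I * ((MvPolynomial.eval (realCoords z) (realify P).2 : ℝ) : ℂ) := by
  rw [← eval_realifyVars P z]
  exact eval_ofReal_eq (realifyVars P) (realCoords z)

/-- `P(z) = 0` iff both parts of the realification vanish at the real coordinates of `z`.
[folklore] -/
theorem eval_eq_zero_iff_realify (P : MvPolynomial σ ℂ) (z : σ → ℂ) :
    MvPolynomial.eval z P = 0 ↔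
      MvPolynomial.eval (realCoords z) (realify P).1 = 0 ∧
        MvPolynomial.eval (realCoords z) (realify P).2 = 0 := by
  rw [eval_eq_realify]
  constructor
  · intro h
    have hre := congrArg Complex.re h
    have him := congrArg Complex.im h
    simp at hre him
    exact ⟨hre, him⟩
  · rintro ⟨h1, h2⟩
    simp [h1, h2]

/-- **A complex system has a common zero iff its realified system has a real common zero.**
[folklore] -/
theorem exists_common_zero_iff_realify {ι : Type*} (S : ι → MvPolynomial σ ℂ) :
    (∃ z : σ → ℂ, ∀ e, MvPolynomial.eval z (S e) = 0) ↔
      ∃ y : σ × Bool → ℝ, ∀ p, MvPolynomial.eval y (realifySystem S p) = 0 := by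
  constructor
  · rintro ⟨z, hz⟩
    refine ⟨realCoords z, fun p => ?_⟩
    obtain ⟨h1, h2⟩ := (eval_eq_zero_iff_realify (S p.1) z).mp (hz p.1)
    rcases p with ⟨e, _ | _⟩
    · simpa [realifySystem] using h1
    · simpa [realifySystem] using h2
  · rintro ⟨y, hy⟩
    refine ⟨complexPoint y, fun e => ?_⟩
    rw [eval_eq_zero_iff_realify, realCoords_complexPoint]
    exact ⟨by simpa [realifySystem] using hy (e, false), by simpa [realifySystem] using hy (e, true)⟩

/-- **SOS refutations of the realification refute the complex system**: if the realified system
of `S` has a static Positivstellensatz refutation then `S` has no complex common zero.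
[cite: Grigoriev2001, Def. 0.5] -/
theorem HasSOSRefutation.no_complex_zero {ι : Type*} [Fintype ι] {S : ι → MvPolynomial σ ℂ}
    {d : ℕ} (h : HasSOSRefutation (realifySystem S) d) (z : σ → ℂ) :
    ∃ e, MvPolynomial.eval z (S e) ≠ 0 := by
  by_contra hz
  simp only [not_exists, not_not] at hz
  obtain ⟨y, hy⟩ := (exists_common_zero_iff_realify S).mp ⟨z, hz⟩
  obtain ⟨p, hp⟩ := h.no_common_zero y
  exact hp (hy p)

end Realify

end Literature.Computability.Complexity
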